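import Literature.Analysis.FluidPDE.NSVorticity
import Literature.Analysis.FluidPDE.SelfSimilarEulerLpExclusion
import HarnessLib

/-!
# Bronzi–Shvydkoy 2015: the energy of a locally self-similar Euler blow-up is two-sided
# `∫_{|y|<L} |v|² ∼ L^{3−2α}` (Thm 1.1), and the energy concentration it implies (Rem. 1.2)

Analysis/FluidPDE statements file (ONE NAMED FACT with cite tag; the rest proved, no `sorry`),
typing the main theorem of

* A. Bronzi, R. Shvydkoy, *On the energy behavior of locally self-similar blowup for the Euler
  equation*, Indiana Univ. Math. J. **64** (2015) 1291–1302 = arXiv:1310.8611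
  [BronziShvydkoy2015] (numbering of the held arXiv text: Thm 1.1, Remarks 1.2–1.5, Lemma 2.1,
  Claim 3.1),

in dimension `N = 3`, companion of `SelfSimilarEulerLpExclusion.lean` (Chae–Shvydkoy 2013, whose
Theorem 3.2 Remark 1.3 of this paper recovers and extends).

## Setting (BS15 §1) and rendering

BS15: "Let `u ∈ C([0,T), H^s(ℝ^N))`, for some `s > N/2 + 1`, `N ≥ 3`, be a solution of the
Euler equations" which is **locally self-similar** in a ball,
`u(x,t) = (T−t)^{−α/(1+α)} v((x−x₀)/(T−t)^{1/(1+α)})` for `x ∈ B_{ρ₀}(x₀)`, `t < T` (display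
(1.3)), with a locally smooth profile `v ∈ C³_loc(ℝ^N)` and "some fixed `α > 0`". No pressure
ansatz is postulated (Lemma 2.1 recovers it) and no equation for `v` is assumed (it follows).

* **Solution class.** Rendered, exactly as the tree renders the same class for
  Constantin–Ignatova–Vicol 2026 Thm 2.1 (`CIV2026_collapseExponent_ge_two_fifths`,
  `PutativeSelfSimilarEuler.lean`), in the Beale–Kato–Majda class of `NSVorticity.lean`: a
  classical unforced Euler solution on `ℝ³ × [0, T)` (`IsClassicalEulerSolutionOn (Ico 0 T) 0 u p`)
  with all Sobolev norms bounded on every compact sub-interval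
  (`∀ T'' < T, HasBoundedSobolevNormsOn (Icc 0 T'') u`, i.e. `u ∈ ⋂ₛ C([0,T''], H^s)`). This is
  the sub-class `s = ∞` of the printed class — a special case, nothing is claimed for a single
  finite `s`.
  -- TODO(general form): one fixed `s > 5/2`; general dimension `N ≥ 3`.
* **Local self-similarity** (1.3): `u t x = selfSimilarCollapse (1/(α+1)) T v t (x − x₀)` for all
  `t ∈ [0, T)` and `x ∈ B_{ρ₀}(x₀)` — the tree's power-law ansatz
  (`SelfSimilarCollapseAnsatz.lean`, `(T−t)^{γ−1} v((T−t)^{−γ}(x − x₀))`, `γ = 1/(α+1)`; the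
  dictionary `γ = 1/(α+1)` is the one of `SelfSimilarEulerLpExclusion.lean`). BS15 Lemma 2.1
  confirms the sign convention: the profile of (1.3) solves
  `α/(1+α) v + 1/(1+α) y·∇v + (v·∇)v + ∇q = 0` (display (2.3)), i.e. the tree's
  `IsSelfSimilarEulerProfile (1/(α+1)) 0 v q` system (CIV (3.3)).
* **Growth hypothesis** (1.7) "`∫_{|y|∼L} |v(y)|^p dy ≲ L^γ` for large `L`", `p ≥ 3`, `γ < p − 2`:
  the dyadic shell `{L < |y| < 2L}` (BS15 §2: `⟨f⟩_{L,2L}` averages over shells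
  `L₁ < |y| < L₂`), `≲` = `≤ C ·` for `L ≥ L₀`; the exponent is called `r` below (real, `3 ≤ r`)
  because `p` is the pressure.
* **Conclusion** (1.8) "either `v = 0` or `L^{N−2α} ≲ ∫_{|y|<L} |v|² ≲ L^{N−2α}`" (`A ≲ B` means
  `A/B` bounded for large `L`, §1): rendered with explicit constants `0 < c`, `C` and a threshold.

## Contents

* FACT `bronziShvydkoy2015_energy_dichotomy` — **Theorem 1.1**.
* PROVED (private helper `setIntegral_comp_sub_ball`, translation of a ball integral)
  **Remark 1.2 (energy concentration)**, first sentence, relative to the fact: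
  `bronziShvydkoy2015_energy_dichotomy.energy_ball_lower_bound` — if `v ≠ 0`, the local energy
  `∫_{B_{ρ₀}(x₀)} |u(t)|² ≥ c ρ₀^{3−2α} > 0` for all `t` near `T` ("the self-similar blowup carries
  some positive amount of energy with it, i.e. `‖u(t)‖_{L²(B_{ρ₀}(x₀))}` stays bounded away from
  zero as time `t` approaches critical"), by the exact scaling
  `‖u(t)‖²_{L²(B_{ρ₀}(x₀))} = L^{2α−N} ∫_{|y|<ρ₀L} |v|²`, `L = (T−t)^{−1/(1+α)}` (display (1.5) =
  the tree's `setIntegral_norm_sq_selfSimilarCollapse_ball`).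

Deliberately NOT here: Remark 1.3 (the exclusion corollaries `γ < N − pα ⇒ v = 0`, recovering
Chae–Shvydkoy Thm 3.2 for `α ≤ N/p` and extending it into the window `N/p < α < N/2` under extra
shell decay — a Hölder-on-shells consequence of Thm 1.1, to be appended as a proved corollary on
request), Remark 1.5 (`α = N/2`), Lemma 2.1 (pressure recovery), Claim 3.1.

## Use

Route `EulerZoomLiouville` (summit NavierStokesRegularity, §B): BC9 ceiling source "energy
equipartition dimension `3 − 2α` for `0 < α < 3/2`" — on exact self-similar members embedded in
a finite-energy smooth flow the `A`-type gauge `a^{2ρ}·a⁻¹∫_{B_a}|u|²` is not only bounded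
(CS13 (1.3), `energyGrowth_of_selfSimilarCollapse_energy_le`) but bounded BELOW unless the profile
is trivial. Users take `(h : bronziShvydkoy2015_energy_dichotomy)` as a hypothesis.

## Mathlib / tree search

`lean search 'Bronzi|bronzi|energy_dichotomy'`: nothing in the tree (docstring citations of
[BronziShvydkoy2015] only, `Summits/…/SoloInformedCollapseWindow.lean`). Reused:
`IsClassicalEulerSolutionOn`, `HasBoundedSobolevNormsOn` (`NSVorticity.lean`),
`selfSimilarCollapse`, `setIntegral_norm_sq_selfSimilarCollapse_ball`; Mathlib
`integral_indicator`, `integral_sub_right_eq_self`, `Real.rpow_*`. No new definitions with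
arguments, no instances, no notation.
-/

noncomputable section

open MeasureTheory Set Filter Topology Metric

namespace Literature.Analysis.FluidPDE

/-! ## The named fact (BS15 Thm 1.1) -/

/-- **Bronzi–Shvydkoy 2015, Theorem 1.1** (`N = 3`, BKM class). Printed: "Suppose
`u ∈ C([0,T), H^s(ℝ^N))` is a solution to (EE) locally self-similar in a ball `B_{ρ₀}(x₀)` with
profile `v ∈ C³_loc(ℝ^N)` and scaling `0 < α < N/2`. Suppose further that for some `p ≥ 3` and
`γ < p − 2`, `∫_{|y|∼L} |v(y)|^p dy ≲ L^γ`, for large `L`. Then either `v = 0` or one has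
`L^{N−2α} ≲ ∫_{|y|<L} |v(y)|² dy ≲ L^{N−2α}`." ("the upper bound … is simply a consequence of the
fact that `v` is a part of the solution `u` with finite energy".) Rendering (module docstring):
classical Euler solution on `ℝ³ × [0,T)` with all Sobolev norms bounded on compact sub-intervals;
`u(t,x) = (T−t)^{−α/(1+α)} v((x−x₀)(T−t)^{−1/(1+α)})` on `B_{ρ₀}(x₀) × [0,T)`
(`selfSimilarCollapse (1/(α+1)) T v`); `v ∈ C³`; the `L^r`-shell growth with real `3 ≤ r`,
`γ < r − 2` on the shells `{L < |y| < 2L}`; two-sided bound with constants `0 < c`, `C` for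
`L ≥ L₀`. [cite: BronziShvydkoy2015, §1 Thm. 1.1] -/
def bronziShvydkoy2015_energy_dichotomy : Prop :=
  ∀ (T α ρ₀ : ℝ) (x₀ : EuclideanSpace ℝ (Fin 3))
    (u : ℝ → EuclideanSpace ℝ (Fin 3) → EuclideanSpace ℝ (Fin 3))
    (p : ℝ → EuclideanSpace ℝ (Fin 3) → ℝ)
    (v : EuclideanSpace ℝ (Fin 3) → EuclideanSpace ℝ (Fin 3)),
    0 < T → 0 < α → α < 3 / 2 → 0 < ρ₀ →
    IsClassicalEulerSolutionOn (Ico 0 T) 0 u p →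
    (∀ T'' < T, HasBoundedSobolevNormsOn (Icc 0 T'') u) →
    ContDiff ℝ 3 v →
    (∀ t ∈ Ico 0 T, ∀ x ∈ ball x₀ ρ₀,
      u t x = selfSimilarCollapse (1 / (α + 1)) T v t (x - x₀)) →
    (∃ r γ C L₀ : ℝ, 3 ≤ r ∧ γ < r - 2 ∧ ∀ L : ℝ, L₀ ≤ L →
      ∫ y in {y : EuclideanSpace ℝ (Fin 3) | L < ‖y‖ ∧ ‖y‖ < 2 * L}, ‖v y‖ ^ r ≤ C * L ^ γ) →
    v = 0 ∨
      ∃ c C L₀ : ℝ, 0 < c ∧ ∀ L : ℝ, L₀ ≤ L →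
        c * L ^ (3 - 2 * α) ≤ ∫ y in ball (0 : EuclideanSpace ℝ (Fin 3)) L, ‖v y‖ ^ 2 ∧
          ∫ y in ball (0 : EuclideanSpace ℝ (Fin 3)) L, ‖v y‖ ^ 2 ≤ C * L ^ (3 - 2 * α)

/-! ## Proved: Remark 1.2 (energy concentration) relative to the fact -/

/-- Translating a ball integral: `∫_{B_ρ(x₀)} f(x − x₀) dx = ∫_{B_ρ(0)} f(z) dz` (Lebesgue measure
on `ℝ³` is translation invariant). [folklore] -/
private theorem setIntegral_comp_sub_ball (f : EuclideanSpace ℝ (Fin 3) → ℝ)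
    (x₀ : EuclideanSpace ℝ (Fin 3)) (ρ : ℝ) :
    ∫ x in ball x₀ ρ, f (x - x₀) = ∫ z in ball (0 : EuclideanSpace ℝ (Fin 3)) ρ, f z := by
  rw [← integral_indicator measurableSet_ball, ← integral_indicator measurableSet_ball]
  have hind : (ball x₀ ρ).indicator (fun x => f (x - x₀)) =
      fun x => (ball (0 : EuclideanSpace ℝ (Fin 3)) ρ).indicator f (x - x₀) := by
    funext x
    have hmem : x ∈ ball x₀ ρ ↔ x - x₀ ∈ ball (0 : EuclideanSpace ℝ (Fin 3)) ρ := by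
      rw [mem_ball, mem_ball, dist_eq_norm, dist_zero_right]
    by_cases hx : x ∈ ball x₀ ρ
    · rw [indicator_of_mem hx, indicator_of_mem (hmem.1 hx)]
    · rw [indicator_of_notMem hx, indicator_of_notMem (fun h => hx (hmem.2 h))]
  rw [hind]
  exact integral_sub_right_eq_self _ x₀

/-- **Bronzi–Shvydkoy 2015, Remark 1.2 (energy concentration), relative to Theorem 1.1.** "In
view of (1.5), the conclusion of the theorem states that unless the profile `v` is trivial, the
self-similar blowup carries some positive amount of energy with it, i.e.
`‖u(t)‖_{L²(B_{ρ₀}(x₀))}` stays bounded away from zero as time `t` approaches critical": under the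
hypotheses of `bronziShvydkoy2015_energy_dichotomy` and `v ≠ 0`, there are `c > 0` and
`0 ≤ t₁ < T` with `∫_{B_{ρ₀}(x₀)} |u(t,x)|² dx ≥ c` for all `t ∈ [t₁, T)`; in fact `c = c₁ ρ₀^{3−2α}` with the
lower constant `c₁` of (1.8), by the exact scaling (1.5)
`‖u(t)‖²_{L²(B_{ρ₀})} = (T−t)^{(3−2α)/(1+α)} ∫_{|y| < ρ₀ (T−t)^{−1/(1+α)}} |v|²`
(`setIntegral_norm_sq_selfSimilarCollapse_ball`). [cite: BronziShvydkoy2015, §1 Rem. 1.2] -/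
theorem bronziShvydkoy2015_energy_dichotomy.energy_ball_lower_bound
    (h : bronziShvydkoy2015_energy_dichotomy) {T α ρ₀ : ℝ} {x₀ : EuclideanSpace ℝ (Fin 3)}
    {u : ℝ → EuclideanSpace ℝ (Fin 3) → EuclideanSpace ℝ (Fin 3)}
    {p : ℝ → EuclideanSpace ℝ (Fin 3) → ℝ}
    {v : EuclideanSpace ℝ (Fin 3) → EuclideanSpace ℝ (Fin 3)}
    (hT : 0 < T) (hα : 0 < α) (hα' : α < 3 / 2) (hρ₀ : 0 < ρ₀)
    (hsol : IsClassicalEulerSolutionOn (Ico 0 T) 0 u p)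
    (hreg : ∀ T'' < T, HasBoundedSobolevNormsOn (Icc 0 T'') u)
    (hv3 : ContDiff ℝ 3 v)
    (hss : ∀ t ∈ Ico 0 T, ∀ x ∈ ball x₀ ρ₀,
      u t x = selfSimilarCollapse (1 / (α + 1)) T v t (x - x₀))
    (hgrowth : ∃ r γ C L₀ : ℝ, 3 ≤ r ∧ γ < r - 2 ∧ ∀ L : ℝ, L₀ ≤ L →
      ∫ y in {y : EuclideanSpace ℝ (Fin 3) | L < ‖y‖ ∧ ‖y‖ < 2 * L}, ‖v y‖ ^ r ≤ C * L ^ γ)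
    (hv : v ≠ 0) :
    ∃ c t₁ : ℝ, 0 < c ∧ 0 ≤ t₁ ∧ t₁ < T ∧ ∀ t ∈ Ico t₁ T,
      c ≤ ∫ x in ball x₀ ρ₀, ‖u t x‖ ^ 2 := by
  obtain ⟨c, C, L₀, hc, hbd⟩ :=
    (h T α ρ₀ x₀ u p v hT hα hα' hρ₀ hsol hreg hv3 hss hgrowth).resolve_left hv
  have hα1 : 0 < α + 1 := by linarith
  set γ : ℝ := 1 / (α + 1) with hγ_def
  have hγ : 0 < γ := by rw [hγ_def]; positivity
  -- threshold time: for `T - t ≤ s₁ := (max L₀ 1 / ρ₀)^{-(α+1)}` the radius `ρ₀ (T−t)^{−γ}` is `≥ L₀`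
  set M : ℝ := max L₀ 1 with hM_def
  have hM : 0 < M := lt_of_lt_of_le one_pos (le_max_right _ _)
  have hMρ : 0 < M / ρ₀ := div_pos hM hρ₀
  set s₁ : ℝ := (M / ρ₀) ^ (-(α + 1)) with hs₁_def
  have hs₁ : 0 < s₁ := Real.rpow_pos_of_pos hMρ _
  refine ⟨c * ρ₀ ^ (3 - 2 * α), max 0 (T - s₁), mul_pos hc (Real.rpow_pos_of_pos hρ₀ _),
    le_max_left _ _, max_lt hT (by linarith), fun t ht => ?_⟩
  have ht0 : 0 ≤ t := (le_max_left _ _).trans ht.1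
  have htT : t < T := ht.2
  have hs : 0 < T - t := sub_pos.mpr htT
  have hsle : T - t ≤ s₁ := by linarith [(le_max_right _ _).trans ht.1]
  -- the self-similar radius at time `t`
  set L : ℝ := ρ₀ * (T - t) ^ (-γ) with hL_def
  have hradius : M ≤ L := by
    -- `(T - t)^{-γ} ≥ s₁^{-γ} = M/ρ₀`
    have h1 : s₁ ^ (-γ) ≤ (T - t) ^ (-γ) :=
      Real.rpow_le_rpow_of_nonpos hs hsle (by linarith)
    have h2 : s₁ ^ (-γ) = M / ρ₀ := by
      rw [hs₁_def, ← Real.rpow_mul hMρ.le]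
      have : -(α + 1) * -γ = 1 := by rw [hγ_def]; field_simp
      rw [this, Real.rpow_one]
    rw [h2] at h1
    calc M = ρ₀ * (M / ρ₀) := by field_simp
      _ ≤ ρ₀ * (T - t) ^ (-γ) := by gcongr
  have hL₀L : L₀ ≤ L := (le_max_left _ _).trans hradius
  have hLpos : 0 < L := hM.trans_le hradius
  -- the energy in the ball, by translation and exact scaling
  have hball : ∫ x in ball x₀ ρ₀, ‖u t x‖ ^ 2 =
      ∫ x in ball x₀ ρ₀, ‖selfSimilarCollapse γ T v t (x - x₀)‖ ^ 2 := by
    refine setIntegral_congr_fun measurableSet_ball fun x hx => ?_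
    rw [hss t ⟨ht0, htT⟩ x hx]
  rw [hball, setIntegral_comp_sub_ball (fun z => ‖selfSimilarCollapse γ T v t z‖ ^ 2) x₀ ρ₀,
    setIntegral_norm_sq_selfSimilarCollapse_ball htT v ρ₀]
  -- lower bound (1.8) at radius `L`
  have hlow : c * L ^ (3 - 2 * α) ≤
      ∫ y in ball (0 : EuclideanSpace ℝ (Fin 3)) L, ‖v y‖ ^ 2 := (hbd L hL₀L).1
  have hpre : 0 < (T - t) ^ (2 * (γ - 1) + 3 * γ) := Real.rpow_pos_of_pos hs _
  -- `(T−t)^{2(γ−1)+3γ} · L^{3−2α} = ρ₀^{3−2α}`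
  have hscale : (T - t) ^ (2 * (γ - 1) + 3 * γ) * L ^ (3 - 2 * α) = ρ₀ ^ (3 - 2 * α) := by
    rw [hL_def, Real.mul_rpow hρ₀.le (Real.rpow_pos_of_pos hs _).le, ← Real.rpow_mul hs.le,
      mul_left_comm, ← Real.rpow_add hs]
    have : 2 * (γ - 1) + 3 * γ + -γ * (3 - 2 * α) = 0 := by
      rw [hγ_def]; field_simp; ring
    rw [this, Real.rpow_zero, mul_one]
  calc c * ρ₀ ^ (3 - 2 * α)
      = (T - t) ^ (2 * (γ - 1) + 3 * γ) * (c * L ^ (3 - 2 * α)) := by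
        rw [← hscale]; ring
    _ ≤ (T - t) ^ (2 * (γ - 1) + 3 * γ) *
          ∫ y in ball (0 : EuclideanSpace ℝ (Fin 3)) L, ‖v y‖ ^ 2 :=
        mul_le_mul_of_nonneg_left hlow hpre.le
    _ = (T - t) ^ (2 * (γ - 1) + 3 * γ) *
          ∫ y in ball (0 : EuclideanSpace ℝ (Fin 3)) (ρ₀ * (T - t) ^ (-γ)), ‖v y‖ ^ 2 := by
        rw [hL_def]

end Literature.Analysis.FluidPDE
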